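import Summits.ABC.ABC.Theses.NegOmegaAtlas
import Summits.ABC.ABC.Theorems.IneffectiveSubspaceUniformSadicTowerFourKillPaths
import Summits.ABC.ABC.Theorems.IneffectiveSubspaceAbcGivesUniformSadic

/-!
# `NegOmegaAtlas.Assembly` (stmt-ABC-1232): `NegThesis → ¬ABC`

The assembly of the negative-side route `NegOmegaAtlas` is a three-arrow corollary of theorems landed
by the crux chain of `IneffectiveSubspace.UniformSadicTowerFour` (stmt-ABC-14937, line `flat-steep-split`,
lead c3): `ABC ⟹ UniformSadicTowerFour` (`abcGivesUniformSadic_proof`) and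
`NegThesis ⟹ ¬UniformSadicTowerFour` (`BoundedOmega.not_uniformSadicTowerFour_of_negThesis`, p150546 —
through `UniformSadicTowerFour ⟹ BoundedOmegaABC ⟺ ¬NegThesis`).  Recorded here so that the cross-route
kill path is visible to the gate from BOTH routes.  Nothing else is in this file.
-/

-- `Summit.<Summit>.<Problem>` is the mandated summit-side namespace (CONVENTIONS §2); for the
-- single-conjunct summit `ABC` the two coincide, so the duplicate `ABC.ABC` is deliberate.
set_option linter.dupNamespace false

namespace Summit.ABC.ABC.Theorems

open Summit.ABC.ABC.Theses.IneffectiveSubspace (UniformSadicTowerFour)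
open Summit.ABC.ABC.Theorems.UniformSadicTowerFour.BoundedOmega (not_uniformSadicTowerFour_of_negThesis)

/-- **`NegOmegaAtlas.Assembly` holds**: an infinite bounded-ω family of quality `> 1 + δ` refutes `ABC`
(indeed it already refutes the crux `UniformSadicTowerFour` of route `IneffectiveSubspace`, which `ABC`
implies). [folklore] -/
theorem negOmegaAtlasAssembly_proof : Summit.ABC.ABC.Theses.NegOmegaAtlas.Assembly := by
  unfold Summit.ABC.ABC.Theses.NegOmegaAtlas.Assembly
  intro h habc
  exact not_uniformSadicTowerFour_of_negThesis h
    ((show ABC → UniformSadicTowerFour from abcGivesUniformSadic_proof) habc)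

end Summit.ABC.ABC.Theorems
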